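import Mathlib
import HarnessLib

/-!
# Noncritical Belyi maps on `ℙ¹`, step V-a: the pole-substitution `p ↦ Σ p_j (xM + M')^j M^{n−j}`

S. Mochizuki, *Noncritical Belyi maps*, Math. J. Okayama Univ. **46** (2004) 105–113
[cite: MochizukiNCBelyi2004], Theorem 2.5 in genus `0` with an arbitrary finite exceptional set;
equivalently Scherr–Zieve, *Separated Belyi maps*, Math. Res. Lett. **21** (2014)
[cite: ScherrZieve2014], Theorem 1 for `C = ℙ¹`.  The tree's one-point theorem
(`NoncriticalBelyi.exists_belyi_noncritical_infty`, abc-iut-S7) protects `∞`; a finite set of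
points `G = roots(M)` (`M ∈ ℚ[x]` separable) is protected by PRE-COMPOSING with
`g(x) := x + M'(x)/M(x) = (xM + M')/M`, a rational map of degree `deg M + 1` with SIMPLE poles
exactly at `G ∪ {∞}`: then `β ∘ g` takes the value `β(∞) ∉ {0,1,∞}` on `G ∪ {∞}`.  In the tree's
`(p, q) ∈ ℚ[x]²` format for rational maps on `ℙ¹` (`BelyiLemma.lean`, `BelyiPreimageCount.lean`)
composing `β = p/q` (`deg ≤ n`) with `g` is the POLE-SUBSTITUTION

  `S_n(p) := Σ_{j ≤ n} p_j · (xM + M')^j · M^{n−j} = M^n · p(g)`   (written out as a `Finset` sum).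

This file is the polynomial bookkeeping of `S_n` (the analogue of `NoncriticalBelyiMoebius.lean` for
the Möbius substitution): degree and leading coefficient of `xM + M'`; additivity `S(p) − S(q) =
S(p − q)`; `deg S(p) ≤ n(m+1)`; the top coefficient `p_n c^n` and the next one `p_n κ + p_{n−1} c^n`
(`c` = leading coefficient of `M`, `κ` independent of `p`) — so that the "unramified at `∞`"
determinant of a pair transforms by the factor `c^{2n}`; the values `S(p)(z) = M(z)^n p(g(z))` off
the poles and `S(p)(γ) = p_n M'(γ)^n` at a pole; and the derivative at a pole
`S(p)'(γ) = n p_n M'(γ)^{n−1}(xM+M')'(γ) + p_{n−1} M'(γ)^n`.  The composition theorem itself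
(Belyi clause via the chain rule, coprimality, protection) is `NoncriticalBelyiPolarComp.lean`.
No definitions, no named facts; classical and undisputed.
-/
namespace Literature.NumberTheory.DiophantineGeometry

open Polynomial Finset

namespace NoncriticalBelyi

section Algebra

variable (p q : ℚ[X]) (n : ℕ) (M : ℚ[X])

/-! ### The numerator `x·M + M'` of `g` -/

/-- `deg (xM + M') = deg M + 1` for `M` of positive degree. [cite: ScherrZieve2014, Thm 1 (proof)] -/
theorem natDegree_X_mul_add_derivative (hM : 0 < M.natDegree) :
    (X * M + derivative M).natDegree = M.natDegree + 1 := by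
  have hM0 : M ≠ 0 := by rintro rfl; simp at hM
  have h1 : (X * M).natDegree = M.natDegree + 1 := by
    rw [mul_comm, natDegree_mul_X hM0]
  have h2 : (derivative M).natDegree < (X * M).natDegree := by
    rw [h1]
    exact lt_of_le_of_lt (natDegree_derivative_le M) (by omega)
  rw [natDegree_add_eq_left_of_natDegree_lt h2, h1]

/-- The leading coefficient of `xM + M'` is that of `M`. [cite: ScherrZieve2014, Thm 1 (proof)] -/
theorem leadingCoeff_X_mul_add_derivative (hM : 0 < M.natDegree) :
    (X * M + derivative M).leadingCoeff = M.leadingCoeff := by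
  have hM0 : M ≠ 0 := by rintro rfl; simp at hM
  have h1 : (X * M).natDegree = M.natDegree + 1 := by
    rw [mul_comm, natDegree_mul_X hM0]
  have h2 : (derivative M).degree < (X * M).degree := by
    rw [degree_eq_natDegree (mul_ne_zero X_ne_zero hM0), h1]
    exact lt_of_le_of_lt (degree_le_natDegree) (by
      exact_mod_cast Nat.lt_succ_of_le ((natDegree_derivative_le M).trans (Nat.sub_le _ _)))
  rw [leadingCoeff_add_of_degree_lt' h2, mul_comm, leadingCoeff_mul_X]

/-! ### Linearity, degree and the top two coefficients of the substitution -/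

/-- The substitution is additive in the substituted polynomial: `S(p) − S(q) = S(p − q)`.
[cite: ScherrZieve2014, Thm 1 (proof)] -/
theorem polar_sub :
    (∑ j ∈ range (n + 1), C (p.coeff j) * (X * M + derivative M) ^ j * M ^ (n - j)) -
      (∑ j ∈ range (n + 1), C (q.coeff j) * (X * M + derivative M) ^ j * M ^ (n - j)) =
      ∑ j ∈ range (n + 1), C ((p - q).coeff j) * (X * M + derivative M) ^ j * M ^ (n - j) := by
  rw [← sum_sub_distrib]
  refine sum_congr rfl fun j _ => ?_
  rw [coeff_sub, C_sub]; ring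

/-- A single term of the substitution has degree `≤ n·deg M + j`.
[cite: ScherrZieve2014, Thm 1 (proof)] -/
theorem polar_term_natDegree_le (hM : 0 < M.natDegree) (j : ℕ) (hj : j ≤ n) (a : ℚ) :
    (C a * (X * M + derivative M) ^ j * M ^ (n - j)).natDegree ≤ n * M.natDegree + j := by
  have hA := natDegree_X_mul_add_derivative M hM
  calc (C a * (X * M + derivative M) ^ j * M ^ (n - j)).natDegree
      ≤ (C a * (X * M + derivative M) ^ j).natDegree + (M ^ (n - j)).natDegree := natDegree_mul_le
    _ ≤ j * (M.natDegree + 1) + (n - j) * M.natDegree := by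
        gcongr
        · exact (natDegree_C_mul_le _ _).trans
            ((natDegree_pow_le_of_le j hA.le).trans (by rw [mul_comm]))
        · exact (natDegree_pow_le_of_le _ le_rfl).trans (by rw [mul_comm])
    _ = n * M.natDegree + j := by
        zify [hj]; ring

/-- `deg S(p) ≤ n (deg M + 1)`. [cite: ScherrZieve2014, Thm 1 (proof)] -/
theorem polar_natDegree_le (hM : 0 < M.natDegree) :
    (∑ j ∈ range (n + 1), C (p.coeff j) * (X * M + derivative M) ^ j * M ^ (n - j)).natDegree ≤
      n * (M.natDegree + 1) := by
  refine natDegree_sum_le_of_forall_le _ _ fun j hj => ?_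
  rw [mem_range] at hj
  calc (C (p.coeff j) * (X * M + derivative M) ^ j * M ^ (n - j)).natDegree
      ≤ n * M.natDegree + j := polar_term_natDegree_le n M hM j (by omega) _
    _ ≤ n * (M.natDegree + 1) := by nlinarith

/-- The top coefficient: `S(p)_{n(m+1)} = p_n · c^n`, `c` the leading coefficient of `M`.
[cite: ScherrZieve2014, Thm 1 (proof)] -/
theorem polar_coeff_top (hM : 0 < M.natDegree) :
    (∑ j ∈ range (n + 1), C (p.coeff j) * (X * M + derivative M) ^ j * M ^ (n - j)).coeff
        (n * (M.natDegree + 1)) = p.coeff n * M.leadingCoeff ^ n := by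
  have hA := natDegree_X_mul_add_derivative M hM
  have hlc := leadingCoeff_X_mul_add_derivative M hM
  rw [finsetSum_coeff, sum_range_succ, sum_eq_zero, zero_add]
  · rw [Nat.sub_self, pow_zero, mul_one, coeff_C_mul, ← hlc, ← coeff_pow_mul_natDegree, hA]
  · intro j hj
    rw [mem_range] at hj
    apply coeff_eq_zero_of_natDegree_lt
    calc (C (p.coeff j) * (X * M + derivative M) ^ j * M ^ (n - j)).natDegree
        ≤ n * M.natDegree + j := polar_term_natDegree_le n M hM j hj.le _
      _ < n * (M.natDegree + 1) := by nlinarith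

/-- The next coefficient: `S(p)_{n(m+1)−1} = p_n · κ + p_{n−1} · c^n`, with
`κ = ((xM + M')^n)_{n(m+1)−1}` independent of `p` (`n, m ≥ 1`).
[cite: ScherrZieve2014, Thm 1 (proof)] -/
theorem polar_coeff_pred (hM : 0 < M.natDegree) (hn : 1 ≤ n) :
    (∑ j ∈ range (n + 1), C (p.coeff j) * (X * M + derivative M) ^ j * M ^ (n - j)).coeff
        (n * (M.natDegree + 1) - 1) =
      p.coeff n * ((X * M + derivative M) ^ n).coeff (n * (M.natDegree + 1) - 1) +
        p.coeff (n - 1) * M.leadingCoeff ^ n := by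
  have hA := natDegree_X_mul_add_derivative M hM
  have hlc := leadingCoeff_X_mul_add_derivative M hM
  obtain ⟨k, rfl⟩ : ∃ k, n = k + 1 := ⟨n - 1, by omega⟩
  rw [finsetSum_coeff, sum_range_succ, sum_range_succ, sum_eq_zero, zero_add]
  · -- the two surviving terms `j = k` and `j = k + 1`
    have e1 : k + 1 - k = 1 := by omega
    rw [e1, pow_one, Nat.sub_self, pow_zero, mul_one, coeff_C_mul, Nat.add_sub_cancel]
    -- term `j = k`: `(C a * A^k * M).coeff ((k+1)(m+1) - 1)` with `(k+1)(m+1) - 1 = k(m+1) + m`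
    have hdeg : (k + 1) * (M.natDegree + 1) - 1 = k * (M.natDegree + 1) + M.natDegree := by
      rw [add_mul, one_mul]; omega
    have hT : (C (p.coeff k) * (X * M + derivative M) ^ k * M).coeff
        ((k + 1) * (M.natDegree + 1) - 1) = p.coeff k * M.leadingCoeff ^ (k + 1) := by
      rw [hdeg, coeff_mul_add_eq_of_natDegree_le (df := k * (M.natDegree + 1))
        (dg := M.natDegree) ?_ le_rfl]
      · rw [coeff_C_mul, ← hA, coeff_pow_mul_natDegree, hlc, coeff_natDegree, pow_succ]; ring
      · exact (natDegree_C_mul_le _ _).trans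
          ((natDegree_pow_le_of_le k hA.le).trans (by rw [mul_comm]))
    rw [hT]; ring
  · intro j hj
    rw [mem_range] at hj
    apply coeff_eq_zero_of_natDegree_lt
    calc (C (p.coeff j) * (X * M + derivative M) ^ j * M ^ (k + 1 - j)).natDegree
        ≤ (k + 1) * M.natDegree + j := polar_term_natDegree_le (k + 1) M hM j (by omega) _
      _ < (k + 1) * (M.natDegree + 1) - 1 := by
          have : (k + 1) * (M.natDegree + 1) = (k + 1) * M.natDegree + (k + 1) := by ring
          omega

/-! ### Values of the substitution at and off the poles -/

/-- Off the poles: `S(p)(z) = M(z)^n · p(g(z))`, `g(z) = z + M'(z)/M(z)`, in any field over `ℚ`.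
[cite: ScherrZieve2014, Thm 1 (proof)] -/
theorem aeval_polar {A : Type*} [Field A] [Algebra ℚ A] (hp : p.natDegree ≤ n) (z : A)
    (hz : aeval z M ≠ 0) :
    aeval z (∑ j ∈ range (n + 1), C (p.coeff j) * (X * M + derivative M) ^ j * M ^ (n - j)) =
      (aeval z M) ^ n * aeval (z + aeval z (derivative M) / aeval z M) p := by
  rw [map_sum, aeval_eq_sum_range' (Nat.lt_succ_of_le hp), mul_sum]
  refine sum_congr rfl fun j hj => ?_
  rw [mem_range] at hj
  simp only [map_mul, map_pow, aeval_C, aeval_X, map_add, Algebra.smul_def]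
  have hsplit : (aeval z M) ^ n = (aeval z M) ^ (n - j) * (aeval z M) ^ j := by
    rw [← pow_add, Nat.sub_add_cancel (by omega)]
  have hg : z + aeval z (derivative M) / aeval z M = (z * aeval z M + aeval z (derivative M)) / aeval z M := by
    field_simp
  rw [hg, hsplit, div_pow]
  have hzj : (aeval z M) ^ j ≠ 0 := pow_ne_zero j hz
  field_simp

/-- At a pole `γ` (`M(γ) = 0`): `S(p)(γ) = p_n · M'(γ)^n` (the composite maps `γ ↦ β(∞)`).
[cite: ScherrZieve2014, Thm 1 (proof)] -/
theorem aeval_polar_of_root {A : Type*} [Field A] [Algebra ℚ A] (z : A) (hz : aeval z M = 0) :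
    aeval z (∑ j ∈ range (n + 1), C (p.coeff j) * (X * M + derivative M) ^ j * M ^ (n - j)) =
      algebraMap ℚ A (p.coeff n) * (aeval z (derivative M)) ^ n := by
  rw [map_sum, sum_range_succ, sum_eq_zero, zero_add]
  · simp only [map_mul, map_pow, aeval_C, aeval_X, map_add, hz, Nat.sub_self, pow_zero, mul_one,
      mul_zero, zero_add]
  · intro j hj
    rw [mem_range] at hj
    simp only [map_mul, map_pow, hz, zero_pow (Nat.sub_ne_zero_of_lt hj), mul_zero]

/-- At a pole `γ`, the DERIVATIVE of the substitution: `S(p)'(γ) = n·p_n·M'(γ)^{n−1}·(xM+M')'(γ) +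
p_{n−1}·M'(γ)^n` (`n ≥ 1`; only the terms `j = n, n−1` survive, `M²` dividing the others).
[cite: ScherrZieve2014, Thm 1 (proof)] -/
theorem aeval_derivative_polar_of_root {A : Type*} [Field A] [Algebra ℚ A] (hn : 1 ≤ n) (z : A)
    (hz : aeval z M = 0) :
    aeval z (derivative
        (∑ j ∈ range (n + 1), C (p.coeff j) * (X * M + derivative M) ^ j * M ^ (n - j))) =
      algebraMap ℚ A (p.coeff n) * n * (aeval z (derivative M)) ^ (n - 1) *
          aeval z (derivative (X * M + derivative M)) +
        algebraMap ℚ A (p.coeff (n - 1)) * (aeval z (derivative M)) ^ n := by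
  obtain ⟨k, rfl⟩ : ∃ k, n = k + 1 := ⟨n - 1, by omega⟩
  rw [derivative_sum, map_sum, sum_range_succ, sum_range_succ, sum_eq_zero, zero_add]
  · have e1 : k + 1 - k = 1 := by omega
    rw [e1, pow_one, Nat.sub_self, pow_zero, mul_one, Nat.add_sub_cancel]
    -- `j = k`: derivative of `C a * A^k * M`
    have hAk : aeval z ((X * M + derivative M) ^ k) = (aeval z (derivative M)) ^ k := by
      simp only [map_pow, map_add, map_mul, aeval_X, hz, mul_zero, zero_add]
    have hA1 : aeval z (X * M + derivative M) = aeval z (derivative M) := by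
      simp only [map_add, map_mul, aeval_X, hz, mul_zero, zero_add]
    simp only [derivative_mul, derivative_C, zero_mul, zero_add, map_add, map_mul, aeval_C, hz,
      mul_zero, hAk, derivative_pow, map_natCast, Nat.add_sub_cancel]
    push_cast
    ring
  · intro j hj
    rw [mem_range] at hj
    -- `M^2 ∣ term`, so the derivative vanishes at the root `z`
    obtain ⟨i, hi⟩ : ∃ i, k + 1 - j = i + 2 := ⟨k + 1 - j - 2, by omega⟩
    have hfac : C (p.coeff j) * (X * M + derivative M) ^ j * M ^ (k + 1 - j) =
        (C (p.coeff j) * (X * M + derivative M) ^ j * M ^ i * M) * M := by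
      rw [hi, pow_add, pow_two]; ring
    rw [hfac, derivative_mul]
    simp only [map_add, map_mul, hz, mul_zero, zero_mul, add_zero]

end Algebra

end NoncriticalBelyi

end Literature.NumberTheory.DiophantineGeometry
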